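import Summits.BirchSwinnertonDyer.BirchSwinnertonDyer.Theorems.EisensteinPrimesCrystalKernel
import Summits.BirchSwinnertonDyer.BirchSwinnertonDyer.Theorems.EisensteinPrimesBSDpOnCellCResidualV11
import Summits.BirchSwinnertonDyer.BirchSwinnertonDyer.Theorems.EisensteinPrimesKellerYinLemma511OfBr
import Summits.BirchSwinnertonDyer.BirchSwinnertonDyer.Theorems.EisensteinPrimesKellerYinBROmegaLightBridges
import Summits.BirchSwinnertonDyer.BirchSwinnertonDyer.Theorems.EisensteinPrimesBSDpOnCellCImprimitiveCountSplitTransport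
import Summits.BirchSwinnertonDyer.BirchSwinnertonDyer.Theorems.EisensteinPrimesBSDpOnCellCImprimitiveCountSplitOfBrHlatLightTC
import Summits.BirchSwinnertonDyer.BirchSwinnertonDyer.Theorems.EisensteinPrimesResidualCharacterSelmerFiniteOfFact
import Summits.BirchSwinnertonDyer.Rank1Residual.X2.CpIntSeriesCongruenceLimit
import Literature.NumberTheory.EllipticCurves.Skinner2016.HidaCongruentMembers
import Literature.NumberTheory.EllipticCurves.BDPAnticyclotomicPAdicLFunctionSigmaInt
import Literature.NumberTheory.EllipticCurves.SigmaEulerData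
import Summits.BirchSwinnertonDyer.BirchSwinnertonDyer.Theorems.ErratumRoadFiveSigmaEulerFactorFirstUnitCoeff
import Summits.BirchSwinnertonDyer.BirchSwinnertonDyer.Theorems.EisensteinPrimesNumPlacesAboveRepresentatives
import Summits.BirchSwinnertonDyer.BirchSwinnertonDyer.Theorems.UniversalToricDescentSigmaEulerMuZero
import Summits.BirchSwinnertonDyer.BirchSwinnertonDyer.Theorems.ErratumRoadFiveIMCDivRoadFFSigmaDataBNoDefect
import Summits.BirchSwinnertonDyer.Rank1Residual.X11b.RouteR1IntReceptacle
import Literature.NumberTheory.EllipticCurves.KellerYin2024.AnticyclotomicLocalEulerFactors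
import Literature.NumberTheory.EllipticCurves.HasseWeilAbelianBadReduction
import Literature.NumberTheory.EllipticCurves.HasseWeilGoodReductionFrobenius
import Literature.NumberTheory.GaloisCohomology.CyclotomicCharacterPPrimary
import Literature.NumberTheory.GaloisRepresentations.LocalFrobeniusDensity
import HarnessLib

/-!
# Line «crystal» of crux 4 `BSDpOnCellC` (stmt-BirchSwinnertonDyer-19034) — the λ-TRANSPORTS as TREE THEOREMS: the unprinted analytic sentences
# [AN-mult] (p668130's `han`, heavy telescope VERBATIM) and [AN-split] (x2-p2 g11's light `han` of p684434/p686519, VERBATIM) DERIVED from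
# (I) the crystalline fibre congruence, (II) `λ(P_Σ) = Σ curveLocalLambda` (tree theorem `CrystalLambdaSigma.lambda_sigmaEulerElement`, fed as a
# hypothesis here) and the member λ-count (ii) resp. (ii′)
# (cell `bsd-eis`; mathematics and Lean text by ideator bsd-idea-12 g14 (`Lines/crystal.lean` v2–v4.1) and the LEAD cruxlead-19034 g0 (v6: light
# telescope); landed under `Theorems/` by the LEAD; `--supports stmt-BirchSwinnertonDyer-19034`; namespace `…Theorems.CrystalTransports`)

HONEST FRAMING: IMPLICATIONS between hypothesis-shaped statements; 0 defs, 0 named facts, 0 sorry; nothing about any curve is asserted; no summit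
statement / BSD / MC / IMC is proved; 0 cells / labels / tiers move. Mechanism: `Q` first unit at `m`, `P_Σ` at `b` ⟹ `Q·P_Σ` at `m + b`
(`X2.CpIntSeries.firstUnitCoeffAt_mul`) ⟹ `Q_{g₁}` at `m + b` (`CrystalfirstUnitCoeffAt_of_span_sup_eq`, index-preserving) ⟹ `m + b ≤ 2 n_φ + ΣΣ`
by the member count; `Sf = Σ(W,p)(K)` by `mem_sigmaPlacesFinset_iff`.

References: [Washington1997] §7.1; [CastellaGrossiLeeSkinner2022] Thm. 2.2.2 with (2.16) (arXiv:2008.02571); [Kriz2016] Thm. 3, Thm. 34, Prop. 37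
(arXiv:1512.05032); [KellerYin2024] §5.1 (b) (arXiv:2402.12781v2 L1775–1778) (shape only); cell `Lines/crystal.md` r7.
-/

set_option autoImplicit false
set_option linter.dupNamespace false

noncomputable section

open scoped Classical MatrixGroups ModularForm

open CongruenceSubgroup WeierstrassCurve NumberField IsDedekindDomain Field PowerSeries
  Literature.NumberTheory.EllipticCurves Literature.NumberTheory.EllipticCurves.GreenbergSelmer
  Literature.NumberTheory.EllipticCurves.ModularForms Literature.NumberTheory.QuadraticFields
  Literature.NumberTheory.EllipticCurves.Rank1Residual
  Literature.NumberTheory.EllipticCurves.Rank1Residual.Typed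
  Literature.NumberTheory.EllipticCurves.KrizLi2019
  Literature.NumberTheory.EllipticCurves.GreenbergVatsal2000
  Literature.NumberTheory.EllipticCurves.Wuthrich2014
  Literature.NumberTheory.EllipticCurves.SteinWuthrich2013
  Literature.NumberTheory.EllipticCurves.Castella2018Exceptional
  Literature.NumberTheory.GaloisRepresentations Literature.NumberTheory.GaloisCohomology
  Literature.NumberTheory.Automorphic
  Summit.BirchSwinnertonDyer.Rank1Residual.X11b.AcSelmer
  Summit.BirchSwinnertonDyer.Rank1Residual.X11b.Halves
  Summit.BirchSwinnertonDyer.Rank1Residual.X11b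
  Summit.BirchSwinnertonDyer.Rank1Residual Summit.BirchSwinnertonDyer.Rank1Residual.X1
  Summit.BirchSwinnertonDyer.Rank1Residual.X2
open Literature.NumberTheory.EllipticCurves.KellerYin2024 (curveLocalLambda)

namespace Summit.BirchSwinnertonDyer.BirchSwinnertonDyer.Theorems.CrystalTransports

open Literature.NumberTheory.EllipticCurves.CastellaGrossiLeeSkinner2022 Literature.NumberTheory.EllipticCurves.Castella2018
  Literature.NumberTheory.IwasawaTheory Literature.NumberTheory.IwasawaTheory.Greenberg2016
  Literature.NumberTheory.IwasawaTheory.Greenberg2006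
  Summit.BirchSwinnertonDyer.Rank1Residual.X1.KellerYinMuLambdaSplit
open Literature.NumberTheory.EllipticCurves.KellerYin2024
open Summit.BirchSwinnertonDyer.BirchSwinnertonDyer.Theorems.CrystalKernel (firstUnitCoeffAt_of_span_sup_eq exists_firstUnitCoeffAt_of_mul)

/-- **p668130's `han` = [AN-mult] («CGLS Thm. 2.2.2's display at `p ‖ N`», THE unprinted analytic sentence of b1's non-split
wall, RESIDUAL-MAP-crux4-b1-g9 §A) DERIVED** from (I) the crystalline member + congruence, (II) the `λ`-dictionary for `P_Σ`,
and (ii) the `λ`-count at the member: `Q` first unit at `m`, `P_Σ` at `b = Σ curveLocalLambda` ⟹ `Q·P_Σ` at `m + b`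
(`X2.CpIntSeries.firstUnitCoeffAt_mul`) ⟹ `Q_{g₁}` at `m + b` (`firstUnitCoeffAt_of_span_sup_eq`, index-preserving)
⟹ `m + b ≤ 2 n_φ + ΣΣ` by (ii); and `Sf = Σ(W,p)(K)` by `mem_sigmaPlaces_iff`. Statement = the `han` binder of
`TeichmullerPairUnramifiedAtMult.imprimitiveCount_nonsplit_of_an_of_br_of_pub''` character for character. No sorry.
[cite: Washington1997, §7.1] [cite: CastellaGrossiLeeSkinner2022, Thm. 2.2.2 with (2.16) (arXiv:2008.02571)]
[cite: KellerYin2024, §5.1 (b) (arXiv:2402.12781v2 L1775–1778) (shape only)] -/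
theorem han_of_crystallineFibre_of_memberInvariants
    (hF :
      ∀ (W : WeierstrassCurve ℚ) [W.IsElliptic] [W.IsGloballyMinimal] (p : ℕ) [Fact p.Prime],
        ∀ (N : ℕ) [NeZero N] (K : Type) [Field K] [NumberField K],
          CellC W p → W.conductorNorm ℤ = N →
          IsImaginaryQuadratic K → NumberField.discr K < -4 → SatisfiesHeegnerHypothesis N K →
          Odd (NumberField.discr K) →
          ∀ (κ : ZpExtension K p), κ.IsAnticyclotomic →
            ∀ (γ : Field.absoluteGaloisGroup K) [Fact (κ.IsTopGenerator γ)]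
              (𝔭 : HeightOneSpectrum (𝓞 K)), ((p : ℕ) : 𝓞 K) ∈ 𝔭.asIdeal →
              𝔭.asIdeal.ramificationIdx (𝓞 ℚ) = 1 → 𝔭.asIdeal.inertiaDeg (𝓞 ℚ) = 1 →
              ∀ (𝔭bar : HeightOneSpectrum (𝓞 K)), ((p : ℕ) : 𝓞 K) ∈ 𝔭bar.asIdeal → 𝔭bar ≠ 𝔭 →
                ((Ideal.span {(p : ℤ)}).primesOver (𝓞 K)).ncard = 2 →
              ∀ (f : CuspForm (CongruenceSubgroup.Gamma0 N) 2), IsNewformOf W f →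
                ∀ (ι' : PadicAlgCl p ≃+* ℂ),
                  (∀ (w : InfinitePlace K) (k : 𝓞 K),
                    k ∈ 𝔭.asIdeal ↔ ‖ι'.symm (w.embedding (k : K))‖ < 1) →
                  ∀ (ΩK : ℂ) (Ωp : ℂ_[p]) (Q : PowerSeries 𝓞_ℂ_[p]), ΩK ≠ 0 → ‖Ωp‖ = 1 →
                    R1.IsBDPLFunctionInt p ι' 𝔭 κ γ f ΩK Ωp Q →
                    ∃ (D : Skinner2016.HidaCongruentForm W p 1) (ΩK' : ℂ) (Ωp' : ℂ_[p])
                      (Qg : PowerSeries 𝓞_ℂ_[p]),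
                      (∀ x : coeffField D.g, ι' (D.ι x) = (x : ℂ)) ∧ 2 * ((p : ℤ) - 1) ∣ D.k - 2 ∧
                      ΩK' ≠ 0 ∧ ‖Ωp'‖ = 1 ∧
                      IsBDPLFunctionWtSigmaInt ι' 𝔭 κ γ D.g (W.sigmaPlacesFinset p K) ΩK' Ωp' Qg ∧
                      Ideal.span {Qg} ⊔ Ideal.span {(C ((p : ℕ) : 𝓞_ℂ_[p]) : PowerSeries 𝓞_ℂ_[p])} =
                        Ideal.span {Q * PowerSeries.map (R1.toCpInt p) (W.sigmaEulerElement p K κ)} ⊔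
                          Ideal.span {(C ((p : ℕ) : 𝓞_ℂ_[p]) : PowerSeries 𝓞_ℂ_[p])})
    (hD3 :
      (∀ (W : WeierstrassCurve ℚ) [W.IsElliptic] [W.IsGloballyMinimal] (p : ℕ) [Fact p.Prime], p ≠ 2 →
        ∀ (K : Type) [Field K] [NumberField K], IsImaginaryQuadratic K →
          SatisfiesHeegnerHypothesis (W.conductorNorm ℤ) K →
          ∀ (κ : ZpExtension K p), κ.IsAnticyclotomic →
            ‖((PowerSeries.coeff (∑ w ∈ W.sigmaPlacesFinset p K, curveLocalLambda κ (W.baseChange K) w)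
                (PowerSeries.map (R1.toCpInt p) (W.sigmaEulerElement p K κ)) : 𝓞_ℂ_[p]) : ℂ_[p])‖ = 1 ∧
            ∀ i < ∑ w ∈ W.sigmaPlacesFinset p K, curveLocalLambda κ (W.baseChange K) w,
              ‖((PowerSeries.coeff i (PowerSeries.map (R1.toCpInt p) (W.sigmaEulerElement p K κ)) : 𝓞_ℂ_[p]) :
                ℂ_[p])‖ < 1))
    (hL :
      (∀ (W : WeierstrassCurve ℚ) [W.IsElliptic] [W.IsGloballyMinimal] (p : ℕ) [Fact p.Prime],
        ∀ (N : ℕ) [NeZero N] (K : Type) [Field K] [NumberField K],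
          CellC W p → ¬ W.HasSplitMultiplicativeReductionAtPrime p → W.conductorNorm ℤ = N →
          IsImaginaryQuadratic K → NumberField.discr K < -4 → SatisfiesHeegnerHypothesis N K →
          Odd (NumberField.discr K) →
          ∀ (κ : ZpExtension K p), κ.IsAnticyclotomic →
            ∀ (γ : Field.absoluteGaloisGroup K) [Fact (κ.IsTopGenerator γ)]
              (𝔭 : HeightOneSpectrum (𝓞 K)), ((p : ℕ) : 𝓞 K) ∈ 𝔭.asIdeal →
              𝔭.asIdeal.ramificationIdx (𝓞 ℚ) = 1 → 𝔭.asIdeal.inertiaDeg (𝓞 ℚ) = 1 →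
              ∀ (𝔭bar : HeightOneSpectrum (𝓞 K)), ((p : ℕ) : 𝓞 K) ∈ 𝔭bar.asIdeal → 𝔭bar ≠ 𝔭 →
                ((Ideal.span {(p : ℤ)}).primesOver (𝓞 K)).ncard = 2 →
              ∀ (ι' : PadicAlgCl p ≃+* ℂ),
                (∀ (w : InfinitePlace K) (k : 𝓞 K),
                  k ∈ 𝔭.asIdeal ↔ ‖ι'.symm (w.embedding (k : K))‖ < 1) →
                ∀ (D : Skinner2016.HidaCongruentForm W p 1), (∀ x : coeffField D.g, ι' (D.ι x) = (x : ℂ)) →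
                  2 * ((p : ℤ) - 1) ∣ D.k - 2 →
                  ∀ (ΩKg : ℂ) (Ωpg : ℂ_[p]) (Qg : PowerSeries 𝓞_ℂ_[p]), ΩKg ≠ 0 → ‖Ωpg‖ = 1 →
                    IsBDPLFunctionWtSigmaInt ι' 𝔭 κ γ D.g (W.sigmaPlacesFinset p K) ΩKg Ωpg Qg →
                    ∀ (Φ : AddSubgroup (geomTorsion W (p : ℤ))), IsRationalLine W p Φ →
                    ∀ (θsub θquot : FramedGaloisRep ℚ (padicCoeffIntegers (∅ : Set (PadicAlgCl p))) 1),
                      IsTeichmullerLiftOn (∅ : Set (PadicAlgCl p)) (Φ.map (geomTorsion W (p : ℤ)).subtype) θsub →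
                      IsTeichmullerLiftOnQuot (∅ : Set (PadicAlgCl p)) (Φ.map (geomTorsion W (p : ℤ)).subtype)
                        (geomTorsion W (p : ℤ)) θquot →
                    ∀ (φ ψ : FramedGaloisRep ℚ (padicCoeffIntegers (∅ : Set (PadicAlgCl p))) 1),
                      (φ = θsub ∧ ψ = θquot ∨ φ = θquot ∧ ψ = θsub) →
                      (∀ u : HeightOneSpectrum (𝓞 ℚ), ((p : ℕ) : 𝓞 ℚ) ∈ u.asIdeal → φ.IsUnramifiedAt u) →
                    ∀ (θK : HeckeCharacter K), IsHeckeCharOf ι' (φ.restrictField K) θK →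
                    ∀ (Cbar : Finset (HeightOneSpectrum (𝓞 K))), (∀ u ∈ Cbar, ¬ θK.IsUnramifiedAt u) →
                    ∀ (ΩK' : ℂ) (Ωp' : (unrIntegers p)ˣ) (Lφ : UnrSeries p), ΩK' ≠ 0 →
                      IsKatzLFunction ι' 𝔭 𝔭bar Cbar κ γ θK ΩK' ((Ωp' : unrIntegers p) : ℂ_[p]) Lφ →
                    ∀ nφ : ℕ, FirstUnitCoeffAt Lφ nφ →
                    ∀ n : ℕ, ‖((PowerSeries.coeff n Qg : 𝓞_ℂ_[p]) : ℂ_[p])‖ = 1 →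
                      (∀ i < n, ‖((PowerSeries.coeff i Qg : 𝓞_ℂ_[p]) : ℂ_[p])‖ < 1) →
                        n ≤ 2 * nφ + ∑ w ∈ W.sigmaPlacesFinset p K,
                          (charLocalLambda (∅ : Set (PadicAlgCl p)) κ (θsub.restrictField K) w +
                            charLocalLambda (∅ : Set (PadicAlgCl p)) κ (θquot.restrictField K) w))) :
      (∀ (W : WeierstrassCurve ℚ) [W.IsElliptic] [W.IsGloballyMinimal] (p : ℕ) [Fact p.Prime],
        ∀ (N : ℕ) [NeZero N] (K : Type) [Field K] [NumberField K] (Dt : ModularParametrizationData W N)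
          (H : HeegnerDatum N (NumberField.discr K)) (ιK : K →+* ℂ) (P : (W.baseChange K).toAffine.Point),
          CellC W p → ¬ W.HasSplitMultiplicativeReductionAtPrime p → W.conductorNorm ℤ = N →
          IsImaginaryQuadratic K → NumberField.discr K < -4 → SatisfiesHeegnerHypothesis N K →
          (W.quadraticTwist (NumberField.discr K : ℚ)).entireLFunction 1 ≠ 0 →
          WeierstrassCurve.Affine.Point.map ιK.toRatAlgHom P = heegnerPointComplex Dt H →
          ¬ (p : ℤ) ∣ Dt.c → ¬ IsOfFinAddOrder P →
          Odd (NumberField.discr K) →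
          ∀ (κ : ZpExtension K p), κ.IsAnticyclotomic →
            ∀ (γ : Field.absoluteGaloisGroup K) [Fact (κ.IsTopGenerator γ)]
              (𝔭 : HeightOneSpectrum (𝓞 K)), ((p : ℕ) : 𝓞 K) ∈ 𝔭.asIdeal →
              𝔭.asIdeal.ramificationIdx (𝓞 ℚ) = 1 → 𝔭.asIdeal.inertiaDeg (𝓞 ℚ) = 1 →
              ∀ (𝔭bar : HeightOneSpectrum (𝓞 K)), ((p : ℕ) : 𝓞 K) ∈ 𝔭bar.asIdeal → 𝔭bar ≠ 𝔭 →
                ((Ideal.span {(p : ℤ)}).primesOver (𝓞 K)).ncard = 2 →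
              ∀ (f : CuspForm (CongruenceSubgroup.Gamma0 N) 2), IsNewformOf W f →
                ∀ (ι' : PadicAlgCl p ≃+* ℂ),
                  (∀ (w : InfinitePlace K) (k : 𝓞 K),
                    k ∈ 𝔭.asIdeal ↔ ‖ι'.symm (w.embedding (k : K))‖ < 1) →
                  ∀ (ΩK : ℂ) (Ωp : ℂ_[p]) (Q : PowerSeries 𝓞_ℂ_[p]), ΩK ≠ 0 → ‖Ωp‖ = 1 →
                    R1.IsBDPLFunctionInt p ι' 𝔭 κ γ f ΩK Ωp Q →
                      ∀ (Sf : Finset (HeightOneSpectrum (𝓞 K))),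
                      (∀ w : HeightOneSpectrum (𝓞 K), w ∈ Sf ↔
                        (((W.conductorNorm ℤ : ℤ) : 𝓞 K) ∈ w.asIdeal ∧ ((p : ℕ) : 𝓞 K) ∉ w.asIdeal)) →
                      ∀ (Φ : AddSubgroup (geomTorsion W (p : ℤ))), IsRationalLine W p Φ →
                      ∀ (θsub θquot : FramedGaloisRep ℚ (padicCoeffIntegers (∅ : Set (PadicAlgCl p))) 1),
                        IsTeichmullerLiftOn (∅ : Set (PadicAlgCl p)) (Φ.map (geomTorsion W (p : ℤ)).subtype) θsub →
                        IsTeichmullerLiftOnQuot (∅ : Set (PadicAlgCl p)) (Φ.map (geomTorsion W (p : ℤ)).subtype)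
                          (geomTorsion W (p : ℤ)) θquot →
                      ∀ (φ ψ : FramedGaloisRep ℚ (padicCoeffIntegers (∅ : Set (PadicAlgCl p))) 1),
                        (φ = θsub ∧ ψ = θquot ∨ φ = θquot ∧ ψ = θsub) →
                        (∀ u : HeightOneSpectrum (𝓞 ℚ), ((p : ℕ) : 𝓞 ℚ) ∈ u.asIdeal → φ.IsUnramifiedAt u) →
                      ∀ (θK : HeckeCharacter K), IsHeckeCharOf ι' (φ.restrictField K) θK →
                      ∀ (Cbar : Finset (HeightOneSpectrum (𝓞 K))), (∀ u ∈ Cbar, ¬ θK.IsUnramifiedAt u) →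
                      ∀ (ΩK' : ℂ) (Ωp' : (unrIntegers p)ˣ) (Lφ : UnrSeries p), ΩK' ≠ 0 →
                        IsKatzLFunction ι' 𝔭 𝔭bar Cbar κ γ θK ΩK' ((Ωp' : unrIntegers p) : ℂ_[p]) Lφ →
                      ∀ nφ : ℕ, FirstUnitCoeffAt Lφ nφ →
                      ∀ m : ℕ, ‖((PowerSeries.coeff m Q : 𝓞_ℂ_[p]) : ℂ_[p])‖ = 1 →
                        (∀ i < m, ‖((PowerSeries.coeff i Q : 𝓞_ℂ_[p]) : ℂ_[p])‖ < 1) →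
                          m + ∑ w ∈ Sf, curveLocalLambda κ (W.baseChange K) w ≤
                            2 * nφ + ∑ w ∈ Sf, (charLocalLambda (∅ : Set (PadicAlgCl p)) κ (θsub.restrictField K) w +
                              charLocalLambda (∅ : Set (PadicAlgCl p)) κ (θquot.restrictField K) w)) := by
  intro W _ _ p _ N _ K _ _ Dt H ιK P hC hns hN hK hD4 hHg hL1 hPt hc hP hodd κ hκ γ _ 𝔭 h𝔭 he hdeg 𝔭bar h𝔭bar hne hsp
    f hf ι' hι' ΩK Ωp Q hΩK hΩp hQ Sf hSf Φ hΦ θsub θquot hsub hquot φ ψ hφψ hunr θK hθK Cbar hCbar ΩK' Ωp' Lφ hΩK'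
    hLφ nφ hnφ m hm hlow
  -- (I): the crystalline member `g₁`, its Σ-frame `Q_{g₁}` and the ideal congruence with `Q · P_Σ`
  obtain ⟨D, ΩKg, Ωpg, Qg, hDι, hpar, hΩKg, hΩpg, hQg, hcong⟩ :=
    hF W p N K hC hN hK hD4 hHg hodd κ hκ γ 𝔭 h𝔭 he hdeg 𝔭bar h𝔭bar hne hsp f hf
      ι' hι' ΩK Ωp Q hΩK hΩp hQ
  -- (II): `P_Σ` has its first unit coefficient at `b = Σ_{w∈Σ} curveLocalLambda`
  have hp2 : p ≠ 2 := hC.2.1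
  have hHg' : SatisfiesHeegnerHypothesis (W.conductorNorm ℤ) K := by rw [hN]; exact hHg
  have hPsig := hD3 W p hp2 K hK hHg' κ hκ
  -- kernel: `Q · P_Σ` has its first unit coefficient at `m + b`, and the congruence transports it to `Q_{g₁}`
  have hQP := Summit.BirchSwinnertonDyer.Rank1Residual.X2.CpIntSeries.firstUnitCoeffAt_mul ⟨hm, hlow⟩ hPsig
  have hQg' := firstUnitCoeffAt_of_span_sup_eq hcong.symm hQP
  -- (ii): the `λ`-count at the member
  have hb := hL W p N K hC hns hN hK hD4 hHg hodd κ hκ γ 𝔭 h𝔭 he hdeg 𝔭bar h𝔭bar hne hsp ι' hι' D hDι hpar ΩKg Ωpg Qg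
    hΩKg hΩpg hQg Φ hΦ θsub θquot hsub hquot φ ψ hφψ hunr θK hθK Cbar hCbar ΩK' Ωp' Lφ hΩK' hLφ nφ hnφ _ hQg'.1 hQg'.2
  -- `Sf = Σ(W, p)(K)`
  have hSf' : Sf = W.sigmaPlacesFinset p K := by
    ext w
    rw [hSf w, WeierstrassCurve.mem_sigmaPlacesFinset_iff, WeierstrassCurve.mem_sigmaPlaces_iff, Int.cast_natCast]
  subst hSf'
  exact hb

/-- **[AN-split] in x2-p2 g11's LIGHT telescope** (the `han` binder of `SplitMultWallHlatLight.imprimitiveCount_split_hlatLight_of_br_of_pub`,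
p684434, VERBATIM) DERIVED from (I) light, (II) and the sign-free member λ-count — the same proof as `hanSplit_of_…` with the idle
Heegner-point binders not introduced. This is what lets v6 DERIVE the split count through x2-p2's isogeny transport
(`ImprimitiveCountSplitTransport.imprimitiveCount_split_of_hlatLight`). No sorry. [cite: Washington1997, §7.1]
[cite: CastellaGrossiLeeSkinner2022, Thm. 2.2.2 with (2.16) (arXiv:2008.02571)] [cite: Kriz2016, Thm. 3, Thm. 34, Prop. 37 (arXiv:1512.05032)] -/
theorem hanSplitLight_of_crystallineFibre_of_memberInvariants
    (hF :
      ∀ (W : WeierstrassCurve ℚ) [W.IsElliptic] [W.IsGloballyMinimal] (p : ℕ) [Fact p.Prime],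
        ∀ (N : ℕ) [NeZero N] (K : Type) [Field K] [NumberField K],
          CellC W p → W.conductorNorm ℤ = N →
          IsImaginaryQuadratic K → NumberField.discr K < -4 → SatisfiesHeegnerHypothesis N K →
          Odd (NumberField.discr K) →
          ∀ (κ : ZpExtension K p), κ.IsAnticyclotomic →
            ∀ (γ : Field.absoluteGaloisGroup K) [Fact (κ.IsTopGenerator γ)]
              (𝔭 : HeightOneSpectrum (𝓞 K)), ((p : ℕ) : 𝓞 K) ∈ 𝔭.asIdeal →
              𝔭.asIdeal.ramificationIdx (𝓞 ℚ) = 1 → 𝔭.asIdeal.inertiaDeg (𝓞 ℚ) = 1 →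
              ∀ (𝔭bar : HeightOneSpectrum (𝓞 K)), ((p : ℕ) : 𝓞 K) ∈ 𝔭bar.asIdeal → 𝔭bar ≠ 𝔭 →
                ((Ideal.span {(p : ℤ)}).primesOver (𝓞 K)).ncard = 2 →
              ∀ (f : CuspForm (CongruenceSubgroup.Gamma0 N) 2), IsNewformOf W f →
                ∀ (ι' : PadicAlgCl p ≃+* ℂ),
                  (∀ (w : InfinitePlace K) (k : 𝓞 K),
                    k ∈ 𝔭.asIdeal ↔ ‖ι'.symm (w.embedding (k : K))‖ < 1) →
                  ∀ (ΩK : ℂ) (Ωp : ℂ_[p]) (Q : PowerSeries 𝓞_ℂ_[p]), ΩK ≠ 0 → ‖Ωp‖ = 1 →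
                    R1.IsBDPLFunctionInt p ι' 𝔭 κ γ f ΩK Ωp Q →
                    ∃ (D : Skinner2016.HidaCongruentForm W p 1) (ΩK' : ℂ) (Ωp' : ℂ_[p])
                      (Qg : PowerSeries 𝓞_ℂ_[p]),
                      (∀ x : coeffField D.g, ι' (D.ι x) = (x : ℂ)) ∧ 2 * ((p : ℤ) - 1) ∣ D.k - 2 ∧
                      ΩK' ≠ 0 ∧ ‖Ωp'‖ = 1 ∧
                      IsBDPLFunctionWtSigmaInt ι' 𝔭 κ γ D.g (W.sigmaPlacesFinset p K) ΩK' Ωp' Qg ∧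
                      Ideal.span {Qg} ⊔ Ideal.span {(C ((p : ℕ) : 𝓞_ℂ_[p]) : PowerSeries 𝓞_ℂ_[p])} =
                        Ideal.span {Q * PowerSeries.map (R1.toCpInt p) (W.sigmaEulerElement p K κ)} ⊔
                          Ideal.span {(C ((p : ℕ) : 𝓞_ℂ_[p]) : PowerSeries 𝓞_ℂ_[p])})
    (hD3 :
      (∀ (W : WeierstrassCurve ℚ) [W.IsElliptic] [W.IsGloballyMinimal] (p : ℕ) [Fact p.Prime], p ≠ 2 →
        ∀ (K : Type) [Field K] [NumberField K], IsImaginaryQuadratic K →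
          SatisfiesHeegnerHypothesis (W.conductorNorm ℤ) K →
          ∀ (κ : ZpExtension K p), κ.IsAnticyclotomic →
            ‖((PowerSeries.coeff (∑ w ∈ W.sigmaPlacesFinset p K, curveLocalLambda κ (W.baseChange K) w)
                (PowerSeries.map (R1.toCpInt p) (W.sigmaEulerElement p K κ)) : 𝓞_ℂ_[p]) : ℂ_[p])‖ = 1 ∧
            ∀ i < ∑ w ∈ W.sigmaPlacesFinset p K, curveLocalLambda κ (W.baseChange K) w,
              ‖((PowerSeries.coeff i (PowerSeries.map (R1.toCpInt p) (W.sigmaEulerElement p K κ)) : 𝓞_ℂ_[p]) :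
                ℂ_[p])‖ < 1))
    (hL :
      (∀ (W : WeierstrassCurve ℚ) [W.IsElliptic] [W.IsGloballyMinimal] (p : ℕ) [Fact p.Prime],
        ∀ (N : ℕ) [NeZero N] (K : Type) [Field K] [NumberField K],
          CellC W p → W.conductorNorm ℤ = N →
          IsImaginaryQuadratic K → NumberField.discr K < -4 → SatisfiesHeegnerHypothesis N K →
          Odd (NumberField.discr K) →
          ∀ (κ : ZpExtension K p), κ.IsAnticyclotomic →
            ∀ (γ : Field.absoluteGaloisGroup K) [Fact (κ.IsTopGenerator γ)]
              (𝔭 : HeightOneSpectrum (𝓞 K)), ((p : ℕ) : 𝓞 K) ∈ 𝔭.asIdeal →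
              𝔭.asIdeal.ramificationIdx (𝓞 ℚ) = 1 → 𝔭.asIdeal.inertiaDeg (𝓞 ℚ) = 1 →
              ∀ (𝔭bar : HeightOneSpectrum (𝓞 K)), ((p : ℕ) : 𝓞 K) ∈ 𝔭bar.asIdeal → 𝔭bar ≠ 𝔭 →
                ((Ideal.span {(p : ℤ)}).primesOver (𝓞 K)).ncard = 2 →
              ∀ (ι' : PadicAlgCl p ≃+* ℂ),
                (∀ (w : InfinitePlace K) (k : 𝓞 K),
                  k ∈ 𝔭.asIdeal ↔ ‖ι'.symm (w.embedding (k : K))‖ < 1) →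
                ∀ (D : Skinner2016.HidaCongruentForm W p 1), (∀ x : coeffField D.g, ι' (D.ι x) = (x : ℂ)) →
                  2 * ((p : ℤ) - 1) ∣ D.k - 2 →
                  ∀ (ΩKg : ℂ) (Ωpg : ℂ_[p]) (Qg : PowerSeries 𝓞_ℂ_[p]), ΩKg ≠ 0 → ‖Ωpg‖ = 1 →
                    IsBDPLFunctionWtSigmaInt ι' 𝔭 κ γ D.g (W.sigmaPlacesFinset p K) ΩKg Ωpg Qg →
                    ∀ (Φ : AddSubgroup (geomTorsion W (p : ℤ))), IsRationalLine W p Φ →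
                    ∀ (θsub θquot : FramedGaloisRep ℚ (padicCoeffIntegers (∅ : Set (PadicAlgCl p))) 1),
                      IsTeichmullerLiftOn (∅ : Set (PadicAlgCl p)) (Φ.map (geomTorsion W (p : ℤ)).subtype) θsub →
                      IsTeichmullerLiftOnQuot (∅ : Set (PadicAlgCl p)) (Φ.map (geomTorsion W (p : ℤ)).subtype)
                        (geomTorsion W (p : ℤ)) θquot →
                    ∀ (φ ψ : FramedGaloisRep ℚ (padicCoeffIntegers (∅ : Set (PadicAlgCl p))) 1),
                      (φ = θsub ∧ ψ = θquot ∨ φ = θquot ∧ ψ = θsub) →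
                      (∀ u : HeightOneSpectrum (𝓞 ℚ), ((p : ℕ) : 𝓞 ℚ) ∈ u.asIdeal → φ.IsUnramifiedAt u) →
                    ∀ (θK : HeckeCharacter K), IsHeckeCharOf ι' (φ.restrictField K) θK →
                    ∀ (Cbar : Finset (HeightOneSpectrum (𝓞 K))), (∀ u ∈ Cbar, ¬ θK.IsUnramifiedAt u) →
                    ∀ (ΩK' : ℂ) (Ωp' : (unrIntegers p)ˣ) (Lφ : UnrSeries p), ΩK' ≠ 0 →
                      IsKatzLFunction ι' 𝔭 𝔭bar Cbar κ γ θK ΩK' ((Ωp' : unrIntegers p) : ℂ_[p]) Lφ →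
                    ∀ nφ : ℕ, FirstUnitCoeffAt Lφ nφ →
                    ∀ n : ℕ, ‖((PowerSeries.coeff n Qg : 𝓞_ℂ_[p]) : ℂ_[p])‖ = 1 →
                      (∀ i < n, ‖((PowerSeries.coeff i Qg : 𝓞_ℂ_[p]) : ℂ_[p])‖ < 1) →
                        n ≤ 2 * nφ + ∑ w ∈ W.sigmaPlacesFinset p K,
                          (charLocalLambda (∅ : Set (PadicAlgCl p)) κ (θsub.restrictField K) w +
                            charLocalLambda (∅ : Set (PadicAlgCl p)) κ (θquot.restrictField K) w))) :
      (∀ (W : WeierstrassCurve ℚ) [W.IsElliptic] [W.IsGloballyMinimal] (p : ℕ) [Fact p.Prime],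
        ∀ (N : ℕ) [NeZero N] (K : Type) [Field K] [NumberField K],
          CellC W p → W.HasSplitMultiplicativeReductionAtPrime p → W.conductorNorm ℤ = N →
          IsImaginaryQuadratic K → NumberField.discr K < -4 → SatisfiesHeegnerHypothesis N K →
          Odd (NumberField.discr K) →
          ∀ (κ : ZpExtension K p), κ.IsAnticyclotomic →
            ∀ (γ : Field.absoluteGaloisGroup K) [Fact (κ.IsTopGenerator γ)]
              (𝔭 : HeightOneSpectrum (𝓞 K)), ((p : ℕ) : 𝓞 K) ∈ 𝔭.asIdeal →
              𝔭.asIdeal.ramificationIdx (𝓞 ℚ) = 1 → 𝔭.asIdeal.inertiaDeg (𝓞 ℚ) = 1 →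
              ∀ (𝔭bar : HeightOneSpectrum (𝓞 K)), ((p : ℕ) : 𝓞 K) ∈ 𝔭bar.asIdeal → 𝔭bar ≠ 𝔭 →
                ((Ideal.span {(p : ℤ)}).primesOver (𝓞 K)).ncard = 2 →
              ∀ (f : CuspForm (CongruenceSubgroup.Gamma0 N) 2), IsNewformOf W f →
                ∀ (ι' : PadicAlgCl p ≃+* ℂ),
                  (∀ (w : InfinitePlace K) (k : 𝓞 K),
                    k ∈ 𝔭.asIdeal ↔ ‖ι'.symm (w.embedding (k : K))‖ < 1) →
                  ∀ (ΩK : ℂ) (Ωp : ℂ_[p]) (Q : PowerSeries 𝓞_ℂ_[p]), ΩK ≠ 0 → ‖Ωp‖ = 1 →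
                    R1.IsBDPLFunctionInt p ι' 𝔭 κ γ f ΩK Ωp Q →
                      ∀ (Sf : Finset (HeightOneSpectrum (𝓞 K))),
                      (∀ w : HeightOneSpectrum (𝓞 K), w ∈ Sf ↔
                        (((W.conductorNorm ℤ : ℤ) : 𝓞 K) ∈ w.asIdeal ∧ ((p : ℕ) : 𝓞 K) ∉ w.asIdeal)) →
                      ∀ (Φ : AddSubgroup (geomTorsion W (p : ℤ))), IsRationalLine W p Φ →
                      ∀ (θsub θquot : FramedGaloisRep ℚ (padicCoeffIntegers (∅ : Set (PadicAlgCl p))) 1),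
                        IsTeichmullerLiftOn (∅ : Set (PadicAlgCl p)) (Φ.map (geomTorsion W (p : ℤ)).subtype) θsub →
                        IsTeichmullerLiftOnQuot (∅ : Set (PadicAlgCl p)) (Φ.map (geomTorsion W (p : ℤ)).subtype)
                          (geomTorsion W (p : ℤ)) θquot →
                      ∀ (φ ψ : FramedGaloisRep ℚ (padicCoeffIntegers (∅ : Set (PadicAlgCl p))) 1),
                        (φ = θsub ∧ ψ = θquot ∨ φ = θquot ∧ ψ = θsub) →
                        (∀ u : HeightOneSpectrum (𝓞 ℚ), ((p : ℕ) : 𝓞 ℚ) ∈ u.asIdeal → φ.IsUnramifiedAt u) →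
                      ∀ (θK : HeckeCharacter K), IsHeckeCharOf ι' (φ.restrictField K) θK →
                      ∀ (Cbar : Finset (HeightOneSpectrum (𝓞 K))), (∀ u ∈ Cbar, ¬ θK.IsUnramifiedAt u) →
                      ∀ (ΩK' : ℂ) (Ωp' : (unrIntegers p)ˣ) (Lφ : UnrSeries p), ΩK' ≠ 0 →
                        IsKatzLFunction ι' 𝔭 𝔭bar Cbar κ γ θK ΩK' ((Ωp' : unrIntegers p) : ℂ_[p]) Lφ →
                      ∀ nφ : ℕ, FirstUnitCoeffAt Lφ nφ →
                      ∀ m : ℕ, ‖((PowerSeries.coeff m Q : 𝓞_ℂ_[p]) : ℂ_[p])‖ = 1 →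
                        (∀ i < m, ‖((PowerSeries.coeff i Q : 𝓞_ℂ_[p]) : ℂ_[p])‖ < 1) →
                          m + ∑ w ∈ Sf, curveLocalLambda κ (W.baseChange K) w ≤
                            2 * nφ + ∑ w ∈ Sf, (charLocalLambda (∅ : Set (PadicAlgCl p)) κ (θsub.restrictField K) w +
                              charLocalLambda (∅ : Set (PadicAlgCl p)) κ (θquot.restrictField K) w)) := by
  intro W _ _ p _ N _ K _ _ hC _hsr hN hK hD4 hHg hodd κ hκ γ _ 𝔭 h𝔭 he hdeg 𝔭bar h𝔭bar hne hsp
    f hf ι' hι' ΩK Ωp Q hΩK hΩp hQ Sf hSf Φ hΦ θsub θquot hsub hquot φ ψ hφψ hunr θK hθK Cbar hCbar ΩK' Ωp' Lφ hΩK'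
    hLφ nφ hnφ m hm hlow
  -- (I): the crystalline member `g₁`, its Σ-frame `Q_{g₁}` and the ideal congruence with `Q · P_Σ`
  obtain ⟨D, ΩKg, Ωpg, Qg, hDι, hpar, hΩKg, hΩpg, hQg, hcong⟩ :=
    hF W p N K hC hN hK hD4 hHg hodd κ hκ γ 𝔭 h𝔭 he hdeg 𝔭bar h𝔭bar hne hsp f hf
      ι' hι' ΩK Ωp Q hΩK hΩp hQ
  -- (II): `P_Σ` has its first unit coefficient at `b = Σ_{w∈Σ} curveLocalLambda`
  have hp2 : p ≠ 2 := hC.2.1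
  have hHg' : SatisfiesHeegnerHypothesis (W.conductorNorm ℤ) K := by rw [hN]; exact hHg
  have hPsig := hD3 W p hp2 K hK hHg' κ hκ
  -- kernel: `Q · P_Σ` has its first unit coefficient at `m + b`, and the congruence transports it to `Q_{g₁}`
  have hQP := Summit.BirchSwinnertonDyer.Rank1Residual.X2.CpIntSeries.firstUnitCoeffAt_mul ⟨hm, hlow⟩ hPsig
  have hQg' := firstUnitCoeffAt_of_span_sup_eq hcong.symm hQP
  -- (ii): the `λ`-count at the member
  have hb := hL W p N K hC hN hK hD4 hHg hodd κ hκ γ 𝔭 h𝔭 he hdeg 𝔭bar h𝔭bar hne hsp ι' hι' D hDι hpar ΩKg Ωpg Qg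
    hΩKg hΩpg hQg Φ hΦ θsub θquot hsub hquot φ ψ hφψ hunr θK hθK Cbar hCbar ΩK' Ωp' Lφ hΩK' hLφ nφ hnφ _ hQg'.1 hQg'.2
  -- `Sf = Σ(W, p)(K)`
  have hSf' : Sf = W.sigmaPlacesFinset p K := by
    ext w
    rw [hSf w, WeierstrassCurve.mem_sigmaPlacesFinset_iff, WeierstrassCurve.mem_sigmaPlaces_iff, Int.cast_natCast]
  subst hSf'
  exact hb

end Summit.BirchSwinnertonDyer.BirchSwinnertonDyer.Theorems.CrystalTransports

end
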